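import Summits.QuantumFields.YangMills.Theorems.UnitScaleTiltProp7PinnedPathBound
import HarnessLib

/-!
# Prop 7, route-R E′, (E1-c) brick F4c(iii) — THE ρ₃-JUNCTION FOR THE TWO SITE TERMS: `ℓ²‖ĉ(ψ x)Z‖ ≤ 2·max(ℓ·sup‖D_Uψ‖, sup‖ψ‖)·(ℓ·min(dist(x,C),ℓ)·‖Z‖)` AND ITS LIPSCHITZ TWIN

Route `UnitScaleTilt`, crux K1 child «MinimiserStabilityRegPr» (`stmt-QuantumFields-19200`), cell ym3-torus, width seat px15 (gen 2); pen «px15 g2: (E1-c) GO-LOCATE» (★p1 g15,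
2026-08-28T20:45:05Z), LOCATE `LOCATE-E1C-DIVLIPSCHITZ-px15g2.md` §6 (F4: ★routeR-w3's ADOPTED third X-row `ρ₃(ψ) = ℓ·sup_x min(dist(x,C),ℓ)‖Δ_Wψ(x)‖`, 2026-08-28T21:18:17Z).
THEOREMS ONLY (0 `def`, 0 `sorry`); `--supports stmt-QuantumFields-19200`, count-neutral.  YM₃ on T³ is a ladder rung (R3), not the Clay problem; nothing here claims the stub,
the crux, d = 4 or the mass gap.

WHY.  F4c(ii) ⧗p672165 `norm_divB_coeffDiff_le` returns two SITE terms unestimated: `ĉ(ψ x)(D*(B−B′)x)` and `[ĉ(ψ x) − ĉ(ψ′ x)](D*B′x)`; with `B = c•D_Wψ` these carry `Δ_W(ψ−ψ′)(x)`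
and `Δ_Wψ′(x)`, which the X-currency controls only through `ρ₃` (weight `ℓ·min(dist(x,C),ℓ)`), NOT through a plain sup (pin cones, px4: `c₂ ≈ 0.74ℓ`).  The weight is recovered from the
coefficient: `‖ĉ(λ)Z‖ ≤ 2‖λ‖‖Z‖` (F4b ✓p671886 `norm_coeff_le_two_mul`) resp. `‖ĉ(λ)Z − ĉ(λ′)Z‖ ≤ κ‖λ−λ′‖‖Z‖`, and `‖ψ(x)‖ ≤ dist(x,C)·sup‖D_Uψ‖` (F4c(i) ✓p672031 `norm_le_potential_mul`)
together with `‖ψ(x)‖ ≤ sup‖ψ‖`; the arithmetic `junction_le` turns the pair into `max(ℓ·sup‖D_Uψ‖, sup‖ψ‖)·(ℓ·min(d(x),ℓ)·‖Z‖) ≤ p(ψ)·ρ₃-type`.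

WHAT IS PROVED (abstract lattice letters of `B9Eq39Adjoint`; generic coefficient `ĉ`; `d : S → ℕ` a potential toward the pinning set `C`):
* `junction_le` — `a ≤ d·δ`, `a ≤ m`, `d, z ≥ 0` ⇒ `ℓ²·(a·z) ≤ max(ℓδ, m)·(ℓ·min(d,ℓ)·z)` (reals, `ℓ ≥ 0`);
* ★★ `norm_siteTerm_le` — `ψ|_C = 0`, `‖D_μψ‖ ≤ δ`, `‖ψ‖ ≤ m ≤ ½`, cone size `‖ĉ(λ)Z‖ ≤ 2‖λ‖‖Z‖` on `‖λ‖ ≤ ½` ⇒ `ℓ²‖ĉ(ψ x)Z‖ ≤ 2·max(ℓδ, m)·(ℓ·min(d x,ℓ)·‖Z‖)`;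
* ★★ `norm_siteDiffTerm_le` — `ψ, ψ′` valued in `‖·‖ ≤ R₀`, `ψ − ψ′` pinned with `‖D_μ(ψ−ψ′)‖ ≤ δ′`, `‖ψ−ψ′‖ ≤ m′`, local Lipschitz `κ` ⇒ `ℓ²‖ĉ(ψ x)Z − ĉ(ψ′ x)Z‖ ≤ κ·max(ℓδ′, m′)·(ℓ·min(d x,ℓ)·‖Z‖)`.
HONEST SCOPE.  Elementary ([folklore]).

References: T. Bałaban, CMP 99 (1985) 389–434 [Balaban1985BackgroundPropagators] ((3.8) p.392); [folklore].
-/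

set_option autoImplicit false

namespace Summit.QuantumFields.YangMills.Theorems.Prop7SiteTermJunction

open Literature.MathematicalPhysics.QuantumFieldTheory.Balaban1983to89.B9Eq39Adjoint (R covD)
open Summit.QuantumFields.YangMills.Theorems.Prop7PinnedPathBound (norm_le_potential_mul)

/-- **THE JUNCTION ARITHMETIC**: `0 ≤ a ≤ d·δ`, `a ≤ m`, `0 ≤ d`, `0 ≤ z`, `0 ≤ ℓ` ⇒ `ℓ²·(a·z) ≤ max(ℓδ, m)·(ℓ·min(d,ℓ)·z)`. [folklore] -/
theorem junction_le {a d δ m z ℓ : ℝ} (hℓ : 0 ≤ ℓ) (hd0 : 0 ≤ d) (had : a ≤ d * δ) (ham : a ≤ m) (hz : 0 ≤ z) :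
    ℓ ^ 2 * (a * z) ≤ max (ℓ * δ) m * (ℓ * min d ℓ * z) := by
  rcases le_total d ℓ with hd | hd
  · rw [min_eq_left hd]
    have h1 : ℓ ^ 2 * (a * z) ≤ ℓ ^ 2 * (d * δ * z) := mul_le_mul_of_nonneg_left (mul_le_mul_of_nonneg_right had hz) (sq_nonneg ℓ)
    have h2 : ℓ * δ * (ℓ * d * z) ≤ max (ℓ * δ) m * (ℓ * d * z) := mul_le_mul_of_nonneg_right (le_max_left _ _) (by positivity)
    calc ℓ ^ 2 * (a * z) ≤ ℓ ^ 2 * (d * δ * z) := h1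
      _ = ℓ * δ * (ℓ * d * z) := by ring
      _ ≤ max (ℓ * δ) m * (ℓ * d * z) := h2
  · rw [min_eq_right hd]
    have h1 : ℓ ^ 2 * (a * z) ≤ ℓ ^ 2 * (m * z) := mul_le_mul_of_nonneg_left (mul_le_mul_of_nonneg_right ham hz) (sq_nonneg ℓ)
    have h2 : m * (ℓ * ℓ * z) ≤ max (ℓ * δ) m * (ℓ * ℓ * z) := mul_le_mul_of_nonneg_right (le_max_right _ _) (by positivity)
    calc ℓ ^ 2 * (a * z) ≤ ℓ ^ 2 * (m * z) := h1
      _ = m * (ℓ * ℓ * z) := by ring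
      _ ≤ max (ℓ * δ) m * (ℓ * ℓ * z) := h2

variable {𝔸 : Type*} [NormedRing 𝔸] {S : Type*} {ι : Type*} (T : ι → Equiv.Perm S) (U : ι → S → 𝔸ˣ)

/-- ★★ **FIRST SITE TERM** (cone size × path bound): `ℓ²‖ĉ(ψ x)Z‖ ≤ 2·max(ℓδ, m)·(ℓ·min(d x, ℓ)·‖Z‖)`. [cite: Balaban1985BackgroundPropagators, (3.8) p.392] -/
theorem norm_siteTerm_le (hR : ∀ μ x (M : 𝔸), ‖R (U μ x) M‖ = ‖M‖) (ĉ : 𝔸 → 𝔸 → 𝔸)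
    (hcone : ∀ lam Z, ‖lam‖ ≤ 1 / 2 → ‖ĉ lam Z‖ ≤ 2 * ‖lam‖ * ‖Z‖)
    (ψ : S → 𝔸) {δ m : ℝ} (hδ0 : 0 ≤ δ) (hδ : ∀ μ x, ‖covD T U μ ψ x‖ ≤ δ) (hm : ∀ x, ‖ψ x‖ ≤ m) (hhalf : m ≤ 1 / 2)
    (C : Set S) (hC : ∀ x ∈ C, ψ x = 0) (d : S → ℕ) (hd : ∀ x, x ∉ C → ∃ μ, d (T μ x) + 1 ≤ d x ∨ d ((T μ).symm x) + 1 ≤ d x)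
    (ℓ : ℕ) (x : S) (Z : 𝔸) :
    (ℓ : ℝ) ^ 2 * ‖ĉ (ψ x) Z‖ ≤ 2 * max ((ℓ : ℝ) * δ) m * ((ℓ : ℝ) * min (d x : ℝ) ℓ * ‖Z‖) := by
  have hpath := norm_le_potential_mul T U hR ψ hδ0 hδ C hC d hd x
  have hc := hcone (ψ x) Z ((hm x).trans hhalf)
  have hj := junction_le (Nat.cast_nonneg ℓ) (Nat.cast_nonneg (d x)) hpath (hm x) (norm_nonneg Z)
  calc (ℓ : ℝ) ^ 2 * ‖ĉ (ψ x) Z‖ ≤ (ℓ : ℝ) ^ 2 * (2 * ‖ψ x‖ * ‖Z‖) := mul_le_mul_of_nonneg_left hc (sq_nonneg _)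
    _ = 2 * ((ℓ : ℝ) ^ 2 * (‖ψ x‖ * ‖Z‖)) := by ring
    _ ≤ 2 * (max ((ℓ : ℝ) * δ) m * ((ℓ : ℝ) * min (d x : ℝ) ℓ * ‖Z‖)) := mul_le_mul_of_nonneg_left hj (by norm_num)
    _ = 2 * max ((ℓ : ℝ) * δ) m * ((ℓ : ℝ) * min (d x : ℝ) ℓ * ‖Z‖) := by ring

/-- ★★ **SECOND SITE TERM** (local Lipschitz × path bound on `ψ − ψ′`): `ℓ²‖ĉ(ψ x)Z − ĉ(ψ′ x)Z‖ ≤ κ·max(ℓδ′, m′)·(ℓ·min(d x, ℓ)·‖Z‖)`. [cite: Balaban1985BackgroundPropagators, (3.8) p.392] -/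
theorem norm_siteDiffTerm_le (hR : ∀ μ x (M : 𝔸), ‖R (U μ x) M‖ = ‖M‖) (ĉ : 𝔸 → 𝔸 → 𝔸) {R₀ κ : ℝ} (hκ0 : 0 ≤ κ)
    (hκ : ∀ lam lam' Z, ‖lam‖ ≤ R₀ → ‖lam'‖ ≤ R₀ → ‖ĉ lam Z - ĉ lam' Z‖ ≤ κ * ‖lam - lam'‖ * ‖Z‖)
    (ψ ψ' : S → 𝔸) (hψ : ∀ y, ‖ψ y‖ ≤ R₀) (hψ' : ∀ y, ‖ψ' y‖ ≤ R₀)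
    {δ' m' : ℝ} (hδ0 : 0 ≤ δ') (hδ : ∀ μ x, ‖covD T U μ (fun y => ψ y - ψ' y) x‖ ≤ δ') (hm : ∀ x, ‖ψ x - ψ' x‖ ≤ m')
    (C : Set S) (hC : ∀ x ∈ C, ψ x - ψ' x = 0) (d : S → ℕ) (hd : ∀ x, x ∉ C → ∃ μ, d (T μ x) + 1 ≤ d x ∨ d ((T μ).symm x) + 1 ≤ d x)
    (ℓ : ℕ) (x : S) (Z : 𝔸) :
    (ℓ : ℝ) ^ 2 * ‖ĉ (ψ x) Z - ĉ (ψ' x) Z‖ ≤ κ * max ((ℓ : ℝ) * δ') m' * ((ℓ : ℝ) * min (d x : ℝ) ℓ * ‖Z‖) := by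
  have hpath := norm_le_potential_mul T U hR (fun y => ψ y - ψ' y) hδ0 hδ C hC d hd x
  have hc := hκ (ψ x) (ψ' x) Z (hψ x) (hψ' x)
  have hj := junction_le (Nat.cast_nonneg ℓ) (Nat.cast_nonneg (d x)) hpath (hm x) (norm_nonneg Z)
  calc (ℓ : ℝ) ^ 2 * ‖ĉ (ψ x) Z - ĉ (ψ' x) Z‖ ≤ (ℓ : ℝ) ^ 2 * (κ * ‖ψ x - ψ' x‖ * ‖Z‖) := mul_le_mul_of_nonneg_left hc (sq_nonneg _)
    _ = κ * ((ℓ : ℝ) ^ 2 * (‖ψ x - ψ' x‖ * ‖Z‖)) := by ring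
    _ ≤ κ * (max ((ℓ : ℝ) * δ') m' * ((ℓ : ℝ) * min (d x : ℝ) ℓ * ‖Z‖)) := mul_le_mul_of_nonneg_left hj hκ0
    _ = κ * max ((ℓ : ℝ) * δ') m' * ((ℓ : ℝ) * min (d x : ℝ) ℓ * ‖Z‖) := by ring

end Summit.QuantumFields.YangMills.Theorems.Prop7SiteTermJunction
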